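import Mathlib.Topology.Separation.Hausdorff
import Mathlib.Topology.Compactness.Compact
import HarnessLib

/-!
# Levelwise agreement of READOUTS with members of a compact set is membership (Cantor intersection through a separating tower of
# continuous readouts) — the «levelwise-to-limit» principle for `lim←`-type compact groups presented by readout maps

Topic `Algebra/InverseSystem`; namespace `Literature.Algebra.InverseSystem`.  Companion of `CompactFamilyLevelwise.lean` (there the ambient space is a
product `Π m, X m` and agreement is agreement of coordinates).  HERE the ambient space `X` is arbitrary and carries a tower of continuous READOUTS
`ψ n : X → Y n` into Hausdorff spaces which (i) propagate downwards on the compact set `A` (agreement with `β` at level `n` forces agreement at the levels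
`m ≤ n` — e.g. the readouts of norm-coherent families, the lower one being the norm of the higher one) and (ii) separate the points of `A` from `β`.  Then a
point `β` which agrees at every level `n` with SOME member of `A` lies in `A`: the pieces `A_n = {α ∈ A | ψ_m α = ψ_m β, m ≤ n}` are compact, non-empty and
decreasing, a common point agrees with `β` at all levels, hence is `β`.  In the tree: `X = Π_j 𝒰(E_j·K_π^∞)`, `A` a closed subgroup of de Shalit's / Rubin's
`U¹_∞(𝔓) = lim←_n U¹((S_n)_{𝔓_n})`, `ψ n` = the level-`n` local unit `ψ_n(β_{n+c,n+b})` (de Shalit III §1.1–1.4).  THEOREMS ONLY (no definition, no named fact,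
no `sorry`).

* ★★ `mem_of_forall_exists_mem_readout_eq` — the principle above;
* `mem_of_forall_exists_mem_forall_le_readout_eq` — the form with agreement on initial segments given directly (no downward propagation needed).

## References
* [deShalit1987] E. de Shalit, *Iwasawa theory of elliptic curves with complex multiplication* (1987), Ch. III §1.1–1.4 (p. 88–91).
* [BourbakiGT1] N. Bourbaki, *General Topology*, Ch. I §9.1 (compact spaces: centred families of closed sets have non-empty intersection).
-/

namespace Literature.Algebra.InverseSystem

section Readout

variable {X : Type*} [TopologicalSpace X] [T2Space X] {Y : ℕ → Type*} [∀ n, TopologicalSpace (Y n)] [∀ n, T2Space (Y n)]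

/-- Agreement of readouts on initial segments with members of a compact set is membership: `A` compact, `ψ n` continuous into Hausdorff spaces and
jointly separating members of `A` from `β`, and for every `n` some `α ∈ A` has `ψ m α = ψ m β` for all `m ≤ n` ⟹ `β ∈ A`.
[cite: deShalit1987, Ch. III §1.4 (p. 90–91)] [cite: BourbakiGT1, Ch. I §9.1] -/
theorem mem_of_forall_exists_mem_forall_le_readout_eq {A : Set X} (hA : IsCompact A) (ψ : ∀ n, X → Y n) (hψ : ∀ n, Continuous (ψ n)) (β : X)
    (hsep : ∀ α ∈ A, (∀ n, ψ n α = ψ n β) → α = β)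
    (h : ∀ n : ℕ, ∃ α ∈ A, ∀ m ≤ n, ψ m α = ψ m β) : β ∈ A := by
  -- the closed, non-empty, decreasing pieces `A_n`
  let S : ℕ → Set X := fun n ↦ A ∩ {α | ∀ m ≤ n, ψ m α = ψ m β}
  have hcl : ∀ n, IsClosed {α : X | ∀ m ≤ n, ψ m α = ψ m β} := by
    intro n
    have e : {α : X | ∀ m ≤ n, ψ m α = ψ m β} = ⋂ m ∈ {m | m ≤ n}, (ψ m) ⁻¹' {ψ m β} := by
      ext α; simp
    rw [e]
    exact isClosed_biInter fun m _ ↦ isClosed_singleton.preimage (hψ m)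
  have hSc : ∀ n, IsCompact (S n) := fun n ↦ hA.inter_right (hcl n)
  have hSne : ∀ n, (S n).Nonempty := fun n ↦ by
    obtain ⟨α, hα, hαβ⟩ := h n
    exact ⟨α, hα, hαβ⟩
  have hmono : ∀ n, S (n + 1) ⊆ S n := fun n α hα ↦ ⟨hα.1, fun m hm ↦ hα.2 m (Nat.le_succ_of_le hm)⟩
  have hanti : Antitone S := antitone_nat_of_succ_le hmono
  have hdir : Directed (· ⊇ ·) S := hanti.directed_ge
  obtain ⟨α, hα⟩ := IsCompact.nonempty_iInter_of_directed_nonempty_isCompact_isClosed S hdir hSne hSc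
    (fun n ↦ (hSc n).isClosed) |>.imp fun α hα ↦ Set.mem_iInter.mp hα
  have hαβ : α = β := hsep α (hα 0).1 fun n ↦ (hα n).2 n le_rfl
  exact hαβ ▸ (hα 0).1

/-- ★★ **Levelwise agreement of readouts with members of a compact set is membership.**  `A ⊆ X` compact; continuous readouts `ψ n : X → Y n` into
Hausdorff spaces which propagate downwards on `A` (`ψ n α = ψ n β ⟹ ψ m α = ψ m β` for `m ≤ n`, `α ∈ A`) and separate members of `A` from `β`; if for every
`n` some `α ∈ A` has `ψ n α = ψ n β`, then `β ∈ A`.  (For `X = Π m, Y m` and `ψ n` the coordinate maps this is `CompactFamilyLevelwise`.)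
[cite: deShalit1987, Ch. III §1.4 (p. 90–91)] [cite: BourbakiGT1, Ch. I §9.1] -/
theorem mem_of_forall_exists_mem_readout_eq {A : Set X} (hA : IsCompact A) (ψ : ∀ n, X → Y n) (hψ : ∀ n, Continuous (ψ n)) (β : X)
    (hdown : ∀ α ∈ A, ∀ n, ψ n α = ψ n β → ∀ m ≤ n, ψ m α = ψ m β)
    (hsep : ∀ α ∈ A, (∀ n, ψ n α = ψ n β) → α = β)
    (h : ∀ n : ℕ, ∃ α ∈ A, ψ n α = ψ n β) : β ∈ A :=
  mem_of_forall_exists_mem_forall_le_readout_eq hA ψ hψ β hsep fun n ↦ by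
    obtain ⟨α, hα, hn⟩ := h n
    exact ⟨α, hα, hdown α hα n hn⟩

end Readout

end Literature.Algebra.InverseSystem
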